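/-
Copyright (c) 2026. All rights reserved.
Released under Apache 2.0 license as described in the file LICENSE.
Authors: abc-iut cell, seat abc-iut-L4-t15 (gen 6).
-/
import Literature.GroupTheory.CommutatorHypocentral
import Mathlib.GroupTheory.Nilpotent
import Mathlib.Algebra.Group.Subgroup.Pointwise
import Mathlib.Order.WellFounded

/-!
# Quasi-minimal normal subgroups (Nikolov–Segal, Ann. of Math. 165 (2007), §4)

A normal subgroup `N` of a group `G` is *quasi-minimal normal* (QMN) if `N = ⁅N, G⁆ > 1` and `N` is
minimal among normal subgroups with this property.  We keep the notion def-free: the hypotheses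
`N.Normal`, `⁅N, ⊤⁆ = N`, `N ≠ ⊥`, `∀ A ⊴ G, A < N → ⁅A, ⊤⁆ = A → A = ⊥` are spelled out.  For a
finite group `G` this file proves (loc. cit. Lemma 4.2 (i) and the remarks before it):

* `commutator_sup_le`, `iterate_commutator_top_sup_le` — `⁅A ⊔ B, C⁆ ≤ ⁅A,C⁆ ⊔ ⁅B,C⁆` for normal
  `A, B, C`, and the same for the lower `G`-central series;
* `exists_qmn_le` — every normal `K = ⁅K, G⁆ ≠ 1` contains a QMN;
* `exists_iterate_commutator_top_eq_bot_of_lt_qmn` — every proper normal subgroup `A < N` of a QMN `N`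
  is `G`-hypocentral: `⁅A,_k G⁆ = 1` for some `k`;
* `exists_max_normal_lt_qmn` — a QMN `N` has a unique maximal proper `G`-normal subgroup `Z = Z_N`:
  `Z ⊴ G`, `Z < N`, and every normal `A < N` satisfies `A ≤ Z` (so `N/Z` is a chief factor of `G`);
* `commutator_le_of_qmn_le_nilpotent` — if `N ≤ P` with `P ⊴ G` nilpotent (lower central series of `P`,
  computed in `G`, reaches `1`), then `⁅N, P⁆ ≤ Z`: the chief factor `N/Z` is centralised by `P`.

Pure finite group theory over Mathlib; no definitions, no instances.  Used by the bounded commutator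
width theorem `Literature/GroupTheory/BoundedCommutatorWidthPByMetacyclic.lean` (cell abc-iut,
GAP-LEDGER G-L3d2g2-1).
-/

namespace Literature.GroupTheory

open scoped commutatorElement Pointwise

variable {G : Type*} [Group G]

/-! ### Commutators of joins of normal subgroups -/

/-- `⁅A ⊔ B, C⁆ ≤ ⁅A, C⁆ ⊔ ⁅B, C⁆` for normal subgroups `A, B, C` (from
`⁅ab, c⁆ = a⁅b,c⁆a⁻¹ ⁅a,c⁆`). [cite: NikolovSegal2007, §4] -/
theorem commutator_sup_le (A B C : Subgroup G) [hA : A.Normal] [hB : B.Normal] [hC : C.Normal] :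
    ⁅A ⊔ B, C⁆ ≤ ⁅A, C⁆ ⊔ ⁅B, C⁆ := by
  rw [Subgroup.commutator_le]
  intro x hx c hc
  have hx' : x ∈ ((A ⊔ B : Subgroup G) : Set G) := hx
  rw [Subgroup.normal_mul] at hx'
  obtain ⟨a, ha, b, hb, rfl⟩ := Set.mem_mul.mp hx'
  rw [commutatorElement_mul_left_eq_conj_mul]
  refine Subgroup.mul_mem _ ?_ (Subgroup.mem_sup_left (Subgroup.commutator_mem_commutator ha hc))
  exact Subgroup.mem_sup_right
    ((Subgroup.commutator_normal B C).conj_mem _ (Subgroup.commutator_mem_commutator hb hc) a)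

/-- The lower `G`-central series of a join: `(A ⊔ B)_k ≤ A_k ⊔ B_k` for normal `A, B`.
[cite: NikolovSegal2007, §4] -/
theorem iterate_commutator_top_sup_le (A B : Subgroup G) [A.Normal] [B.Normal] (k : ℕ) :
    (fun K : Subgroup G => ⁅K, (⊤ : Subgroup G)⁆)^[k] (A ⊔ B) ≤
      (fun K : Subgroup G => ⁅K, (⊤ : Subgroup G)⁆)^[k] A ⊔
        (fun K : Subgroup G => ⁅K, (⊤ : Subgroup G)⁆)^[k] B := by
  induction k with
  | zero => exact le_rfl
  | succ k ih =>
    haveI := normal_iterate_commutator_top A k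
    haveI := normal_iterate_commutator_top B k
    simp only [Function.iterate_succ_apply']
    exact (Subgroup.commutator_mono ih le_rfl).trans (commutator_sup_le _ _ _)

/-- If `⁅A, G⁆ = A` then every term of the lower `G`-central series of `A` equals `A`.
[cite: NikolovSegal2007, §4] -/
theorem iterate_commutator_top_eq_self_of_eq (A : Subgroup G) (hA : ⁅A, (⊤ : Subgroup G)⁆ = A)
    (k : ℕ) : (fun K : Subgroup G => ⁅K, (⊤ : Subgroup G)⁆)^[k] A = A := by
  induction k with
  | zero => rfl
  | succ k ih => rw [Function.iterate_succ_apply', ih, hA]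

/-! ### Existence of quasi-minimal normal subgroups -/

/-- **Existence of QMNs.** In a finite group, every normal subgroup `K` with `⁅K, G⁆ = K ≠ 1` contains a
quasi-minimal normal subgroup `N`: `N ⊴ G`, `⁅N, G⁆ = N ≠ 1`, and every normal `A < N` with
`⁅A, G⁆ = A` is trivial. [cite: NikolovSegal2007, §4] -/
theorem exists_qmn_le [Finite G] (K : Subgroup G) [hK : K.Normal] (hKG : ⁅K, (⊤ : Subgroup G)⁆ = K)
    (hK1 : K ≠ ⊥) :
    ∃ N : Subgroup G, N ≤ K ∧ N.Normal ∧ ⁅N, (⊤ : Subgroup G)⁆ = N ∧ N ≠ ⊥ ∧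
      ∀ A : Subgroup G, A.Normal → A < N → ⁅A, (⊤ : Subgroup G)⁆ = A → A = ⊥ := by
  classical
  let S : Set (Subgroup G) :=
    {A | A ≤ K ∧ A.Normal ∧ ⁅A, (⊤ : Subgroup G)⁆ = A ∧ A ≠ ⊥}
  have hSne : S.Nonempty := ⟨K, le_rfl, hK, hKG, hK1⟩
  haveI : Finite (Subgroup G) := inferInstance
  obtain ⟨N, ⟨hNK, hNn, hNG, hN1⟩, hmin⟩ := (wellFounded_lt (α := Subgroup G)).has_min S hSne
  exact ⟨N, hNK, hNn, hNG, hN1, fun A hAn hAN hAG => by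
    by_contra hA1
    exact hmin A ⟨hAN.le.trans hNK, hAn, hAG, hA1⟩ hAN⟩

/-! ### Proper normal subgroups of a QMN are hypocentral -/

/-- **Proper normal subgroups of a QMN are `G`-hypocentral.** If `N` is quasi-minimal normal in the finite
group `G` and `A ⊴ G` with `A < N`, then `⁅A,_k G⁆ = 1` for some `k` (the series `A ⊇ ⁅A,G⁆ ⊇ ⋯`
stabilises at a term `A' = ⁅A', G⁆ < N`, which is trivial by minimality).
[cite: NikolovSegal2007, Lemma 4.2] -/
theorem exists_iterate_commutator_top_eq_bot_of_lt_qmn [Finite G] {N : Subgroup G}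
    (hmin : ∀ A : Subgroup G, A.Normal → A < N → ⁅A, (⊤ : Subgroup G)⁆ = A → A = ⊥)
    (A : Subgroup G) [hA : A.Normal] (hAN : A < N) :
    ∃ k : ℕ, (fun K : Subgroup G => ⁅K, (⊤ : Subgroup G)⁆)^[k] A = ⊥ := by
  obtain ⟨k, hk⟩ := exists_iterate_commutator_top_eq_succ A
  refine ⟨k, hmin _ (normal_iterate_commutator_top A k)
    (lt_of_le_of_lt (iterate_commutator_top_le A k) hAN) hk⟩

/-! ### The maximal proper normal subgroup `Z_N` of a QMN -/

/-- **The subgroup `Z_N`.** A quasi-minimal normal subgroup `N` of a finite group `G` has a unique maximal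
proper `G`-normal subgroup `Z`: `Z ⊴ G`, `Z < N`, and EVERY normal `A < N` satisfies `A ≤ Z`
(if `A, Z < N` are normal then `A ⊔ Z < N`, since `A ⊔ Z = N` would make `N = ⁅N,_k G⁆ ≤ ⁅A,_kG⁆⁅Z,_kG⁆ = 1`).
In particular `N/Z` is a chief factor of `G`. [cite: NikolovSegal2007, Lemma 4.2] -/
theorem exists_max_normal_lt_qmn [Finite G] (N : Subgroup G)
    (hNG : ⁅N, (⊤ : Subgroup G)⁆ = N) (hN1 : N ≠ ⊥)
    (hmin : ∀ A : Subgroup G, A.Normal → A < N → ⁅A, (⊤ : Subgroup G)⁆ = A → A = ⊥) :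
    ∃ Z : Subgroup G, Z.Normal ∧ Z < N ∧ ∀ A : Subgroup G, A.Normal → A < N → A ≤ Z := by
  classical
  -- key: two proper normal subgroups have a proper join
  have hjoin : ∀ A B : Subgroup G, A.Normal → B.Normal → A < N → B < N → A ⊔ B < N := by
    intro A B hA hB hAN hBN
    haveI := hA; haveI := hB
    refine lt_of_le_of_ne (sup_le hAN.le hBN.le) fun hABN => hN1 ?_
    obtain ⟨a, ha⟩ := exists_iterate_commutator_top_eq_bot_of_lt_qmn hmin A hAN
    obtain ⟨b, hb⟩ := exists_iterate_commutator_top_eq_bot_of_lt_qmn hmin B hBN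
    have hNk : (fun K : Subgroup G => ⁅K, (⊤ : Subgroup G)⁆)^[a + b] N = N :=
      iterate_commutator_top_eq_self_of_eq N hNG (a + b)
    rw [← hNk, ← hABN, eq_bot_iff]
    refine (iterate_commutator_top_sup_le A B (a + b)).trans (sup_le ?_ ?_)
    · rw [← ha]; exact iterate_commutator_top_le_of_le A (Nat.le_add_right a b)
    · rw [← hb]; exact iterate_commutator_top_le_of_le B (Nat.le_add_left b a)
  -- a maximal element of the finite nonempty set of proper normal subgroups
  let S : Set (Subgroup G) := {A | A.Normal ∧ A < N}
  have hSne : S.Nonempty := ⟨⊥, inferInstance, bot_lt_iff_ne_bot.mpr hN1⟩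
  haveI : Finite (Subgroup G) := inferInstance
  obtain ⟨Z, ⟨hZn, hZN⟩, hmax⟩ := (wellFounded_gt (α := Subgroup G)).has_min S hSne
  refine ⟨Z, hZn, hZN, fun A hA hAN => ?_⟩
  -- `A ⊔ Z ∈ S` and `Z ≤ A ⊔ Z`, so by maximality `A ⊔ Z = Z`
  have hAZ : A ⊔ Z < N := hjoin A Z hA hZn hAN hZN
  haveI := hA; haveI := hZn
  have hmem : A ⊔ Z ∈ S := ⟨inferInstance, hAZ⟩
  have := hmax (A ⊔ Z) hmem
  have hle : ¬ Z < A ⊔ Z := fun h => this h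
  have heq : A ⊔ Z = Z := (eq_of_le_of_not_lt le_sup_right hle).symm
  exact le_sup_left.trans heq.le

/-! ### The chief factor of a QMN inside a nilpotent normal subgroup is centralised by it -/

/-- **`⁅N, P⁆ ≤ Z_N`.** Let `N` be quasi-minimal normal with maximal proper normal subgroup `Z`
(`exists_max_normal_lt_qmn`), and let `P ⊴ G` with `N ≤ P` be nilpotent in the sense that its lower
central series computed in `G` vanishes (`P.lowerCentralSeries c = ⊥`; automatic for a finite
`p`-group).  Then `⁅N, P⁆ ≤ Z`: otherwise `⁅N,P⁆ = N`, forcing `N ≤ P.lowerCentralSeries k` for all `k`.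
[cite: NikolovSegal2007, Lemma 4.2] -/
theorem commutator_le_of_qmn_le_nilpotent (N Z P : Subgroup G) [hNn : N.Normal] [hPn : P.Normal]
    (hN1 : N ≠ ⊥) (hZmax : ∀ A : Subgroup G, A.Normal → A < N → A ≤ Z) (hNP : N ≤ P)
    {c : ℕ} (hPc : P.lowerCentralSeries c = ⊥) : ⁅N, P⁆ ≤ Z := by
  have hle : ⁅N, P⁆ ≤ N := Subgroup.commutator_le_left N P
  rcases hle.lt_or_eq with hlt | heq
  · exact hZmax _ inferInstance hlt
  · exfalso
    apply hN1
    -- `N = ⁅N, P⁆` forces `N ≤ γ_k(P)` for all `k`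
    have hNk : ∀ k, N ≤ P.lowerCentralSeries k := by
      intro k
      induction k with
      | zero => simpa using hNP
      | succ k ih =>
        rw [Subgroup.lowerCentralSeries_succ, ← heq]
        exact Subgroup.commutator_mono ih le_rfl
    rw [eq_bot_iff, ← hPc]
    exact hNk c

/-- For a finite `p`-subgroup `P` of `G` the lower central series computed in `G` vanishes:
`P.lowerCentralSeries c = ⊥` for some `c` (finite `p`-groups are nilpotent; Mathlib).
[cite: NikolovSegal2007, §4] -/
theorem exists_lowerCentralSeries_eq_bot_of_isPGroup {p : ℕ} [Fact p.Prime] (P : Subgroup G)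
    [Finite P] (hP : IsPGroup p P) : ∃ c : ℕ, P.lowerCentralSeries c = ⊥ := by
  haveI : Group.IsNilpotent P := hP.isNilpotent
  exact (Subgroup.isNilpotent_iff_lowerCentralSeries P).mp inferInstance

end Literature.GroupTheory
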